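import Mathlib
import Literature.MathematicalPhysics.MHD.BallooningSAlpha
import HarnessLib

/-!
# F3 row «F3.BALLOON-sα-QUARTIC-BUMP»: the one-surface `s–α` ballooning energy of the quartic bump `X(θ) = (π² − θ²)²` on `[−π, π]` in CLOSED FORM — an explicit conic in `(s, α)` — and the certified INNER region of the `s–α` unstable band it yields

LADDER-GRIDFUSION rung F3 (cell `gridfusion`; the pressure-driven half of the peeling–ballooning apex), booked by
gridfusion-lead g11 RULING 9ef (1) («#184-cand F3.BALLOON-sα-QUARTIC-BUMP-THM»); statements + proofs by gridfusion-model-7 g8,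
2026-08-28, over gridfusion-lit-3's `Literature/MathematicalPhysics/MHD/BallooningSAlpha.lean` (the `s–α` model (12.97), its
energy `SAlpha.energy` and the printed sufficient condition for instability `SAlpha.UnstableWitness`).  0 kit, 0 named facts,
no `native_decide`; `π` enters the instances only through Mathlib's certified bounds `Real.pi_gt_d6` / `Real.pi_lt_d6`.

## What is PROVED
* (A) CLOSED FORM.  For the compactly supported trial function `X(θ) = (π² − θ²)²`, `X′(θ) = −4θ(π² − θ²)` on the window
  `[−π, π]` (one poloidal transit, `X(±π) = 0`), the `s–α` energy
  `W(s, α) = ∫_{−π}^{π} [(1 + Λ²)X′² − α(Λ sin θ + cos θ)X²] dθ`, `Λ = sθ − α sin θ`, is EXACTLY the conic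
  `W = c₀ + c₁ s² + c₂ sα + c₃ α² + c₄ α` with
  `c₀ = 256π⁷/105`, `c₁ = 256π⁹/315`, `c₂ = −403200π + 42240π³ − 256π⁵`,
  `c₃ = −45π/2 + 12π³ + 128π⁷/105 + 128π⁹/315`, `c₄ = −80640π + 7680π³`
  (`energy_eq_conic`; method: an explicit antiderivative `F = A + B sin θ + C cos θ + D sin θ cos θ + E sin²θ + G cos²θ` with
  polynomial `A, …, G`, whose derivative is the integrand IDENTICALLY (no use of `sin² + cos² = 1`), the fundamental theorem of
  calculus, and `sin(±π) = 0`, `cos(±π) = −1`).  Numerically `W/c₀ ≈ 1 + 3.290 s² − 4.797 sα + 2.186 α² − 2.065 α`.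
* (B) `conic s α < 0 → SAlpha.UnstableWitness s α (−π) π X X′` (`unstableWitness_of_conic_neg`): at every `(s, α)` inside the
  conic the MODEL admits a compactly supported trial function with negative one-surface energy.  The quadratic part of the conic
  is positive definite, so the certified region is the interior of an ELLIPSE in the `(s, α)` plane — an INNER region of the
  model's unstable band, nothing more (one trial function; `SAlpha.UnstableWitness` is sufficient, not necessary).
* (C) INSTANCES from the enclosures `7363 < c₀ < 7364`, … (`Real.pi_gt_d6`/`pi_lt_d6`): the surfaces `(s, α) = (½, 1)`, `(1, 1)`,
  `(1, 2)`, `(2, 3)` carry a witness, and so does EVERY `(1, α)` with `87/100 ≤ α ≤ 227/100` (`unstableWitness_one_of_mem`; the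
  conic's own band at `s = 1` is `α ∈ (0.862…, 2.278…)`).

## THREE COLUMNS
CERTIFIED: for the `s–α` ballooning MODEL (Freidberg (12.96)–(12.99); Connor–Hastie–Taylor 1979) the one-surface energy of the
quartic bump on `[−π, π]` is the explicit conic above; at every `(s, α)` inside it — e.g. `(½,1)`, `(1,1)`, `(1,2)`, `(2,3)`, and
all `(1, α)`, `0.87 ≤ α ≤ 2.27` — the MODEL admits a compactly supported trial function with `W < 0` (`SAlpha.UnstableWitness`).
VALIDATED: juxtaposed with the printed `s–α` diagram (Freidberg Fig. 12.5, «cannot be solved purely analytically … easily obtained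
numerically») and the fit `α ≈ 0.6 s` of the first-stability boundary (12.100): an inner region of the printed unstable band;
nothing numerical enters the kernel except Mathlib's `π` bounds.  MODELLED: `s–α` model (large-aspect-ratio shifted circles,
high-`n` ballooning ordering, `θ₀ = 0`, ideal MHD); «unstable» here = the MODEL's one-surface energy admits a negative trial
function — the representation step `W̄ < 0 ⇒ 2-D δW < 0` (Connor–Hastie–Taylor 1979) is QUOTED in the Literature file, NOT
typed; no device, no `β`-limit, no second-stability claim.

Citations: J. P. Freidberg, *Ideal MHD* (CUP 2014) §12.3 eqs. (12.38)–(12.40), §12.6.2 eqs. (12.96)–(12.100), Fig. 12.5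
[Freidberg2014]; the objects are lit-3's (`BallooningSAlpha`).  Everything in this file is [instance data] over those objects:
the choice of trial function and window, the polynomial bookkeeping, and Mathlib's `π` bounds.
-/

noncomputable section

open Real MeasureTheory intervalIntegral Set
open Literature.MathematicalPhysics.MHD.Ballooning

namespace Summit.Ventures.FusionMHD.Models

namespace SAlphaQuarticBump

/-! ### §1 The trial function -/

/-- The quartic bump `X(θ) = (π² − θ²)²` — a `C^∞` trial function vanishing (to second order) at `θ = ±π`. [instance data] -/
def bumpX (θ : ℝ) : ℝ := (π ^ 2 - θ ^ 2) ^ 2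

/-- Its derivative `X′(θ) = −4θ(π² − θ²)`. [instance data] -/
def bumpX' (θ : ℝ) : ℝ := -4 * θ * (π ^ 2 - θ ^ 2)

/-- `X′` is the derivative of `X` (everywhere). [instance data] -/
theorem hasDerivAt_bumpX (θ : ℝ) : HasDerivAt bumpX (bumpX' θ) θ := by
  have e : bumpX = fun x : ℝ => (π ^ 2 - x * x) * (π ^ 2 - x * x) := by
    funext x; unfold bumpX; ring
  rw [e]
  have h1 := ((hasDerivAt_id' θ).mul (hasDerivAt_id' θ)).const_sub (π ^ 2)
  have h := h1.mul h1
  refine h.congr_deriv ?_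
  simp only [bumpX', Pi.mul_apply]
  ring

/-- `X(π) = 0`. [instance data] -/
theorem bumpX_pi : bumpX π = 0 := by unfold bumpX; ring

/-- `X(−π) = 0`. [instance data] -/
theorem bumpX_neg_pi : bumpX (-π) = 0 := by unfold bumpX; ring

/-- The bump is POSITIVE strictly inside the window (it is a genuine, non-trivial trial function). [instance data] -/
theorem bumpX_pos {θ : ℝ} (h1 : -π < θ) (h2 : θ < π) : 0 < bumpX θ := by
  unfold bumpX
  have h3 : 0 < π ^ 2 - θ ^ 2 := by nlinarith [mul_pos (sub_pos.2 h2) (show 0 < π + θ by linarith)]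
  exact pow_pos h3 2

/-- The `s–α` energy density of the bump is a continuous function of `θ` (polynomial–trigonometric). [instance data] -/
theorem continuous_energyDensity_bump (s α : ℝ) :
    Continuous (fun θ => SAlpha.energyDensity s α bumpX bumpX' θ) := by
  unfold SAlpha.energyDensity SAlpha.bending SAlpha.drive SAlpha.shearParam bumpX bumpX'
  fun_prop

/-! ### §2 Polynomial bookkeeping: Horner lists and their derivatives -/

/-- Horner evaluation of a real coefficient list, `hornerEval [a₀, a₁, …] x = a₀ + x (a₁ + x (…))`. [instance data] -/
def hornerEval : List ℝ → ℝ → ℝ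
  | [], _ => 0
  | a :: l, x => a + x * hornerEval l x

/-- The derivative of `hornerEval l` as an expression tree: `(a + x·q(x))′ = q(x) + x·q′(x)`. [instance data] -/
def hornerDeriv : List ℝ → ℝ → ℝ
  | [], _ => 0
  | _ :: l, x => hornerEval l x + x * hornerDeriv l x

/-- `hornerDeriv l x` IS the derivative of `hornerEval l` at `x`. [instance data] -/
theorem hasDerivAt_hornerEval (l : List ℝ) (x : ℝ) :
    HasDerivAt (fun y => hornerEval l y) (hornerDeriv l x) x := by
  induction l with
  | nil =>
    simp only [hornerEval, hornerDeriv]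
    exact hasDerivAt_const x 0
  | cons a l ih =>
    simp only [hornerEval, hornerDeriv]
    have h := ((hasDerivAt_id' x).mul ih).const_add a
    refine h.congr_deriv ?_
    ring

/-! ### §3 The closed form: the five conic coefficients and the antiderivative -/

/-- The constant coefficient `c₀ = ∫16θ²(π²−θ²)² = 256π⁷/105` (the shear-free, pressure-free line bending). [instance data] -/
def c0 : ℝ := (256 / 105 : ℝ) * π ^ 7

/-- The `s²` coefficient `c₁ = ∫16θ⁴(π²−θ²)² = 256π⁹/315` (secular-shear line bending). [instance data] -/
def c1 : ℝ := (256 / 315 : ℝ) * π ^ 9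

/-- The `sα` coefficient `c₂ = −∫[32θ³(π²−θ²)² + θ(π²−θ²)⁴] sin θ = −403200π + 42240π³ − 256π⁵` (shear–geodesic cross term). [instance data] -/
def c2 : ℝ := (-403200 : ℝ) * π + (42240 : ℝ) * π ^ 3 + (-256 : ℝ) * π ^ 5

/-- The `α²` coefficient `c₃ = ∫[16θ²(π²−θ²)² + (π²−θ²)⁴] sin²θ = −45π/2 + 12π³ + 128π⁷/105 + 128π⁹/315` (pressure-modulated bending + geodesic drive). [instance data] -/
def c3 : ℝ := (-45 / 2 : ℝ) * π + (12 : ℝ) * π ^ 3 + (128 / 105 : ℝ) * π ^ 7 + (128 / 315 : ℝ) * π ^ 9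

/-- The `α` coefficient `c₄ = −∫(π²−θ²)⁴ cos θ = −80640π + 7680π³` (normal-curvature drive; negative = destabilising). [instance data] -/
def c4 : ℝ := (-80640 : ℝ) * π + (7680 : ℝ) * π ^ 3

/-- THE CONIC: the closed-form one-surface energy `W(s, α) = c₀ + c₁ s² + c₂ sα + c₃ α² + c₄ α` of the quartic bump on
`[−π, π]` (proved equal to `SAlpha.energy` in `energy_eq_conic`). [instance data] -/
def conic (s α : ℝ) : ℝ := c0 + c1 * s ^ 2 + c2 * s * α + c3 * α ^ 2 + c4 * α

/-- Horner coefficient list (in `θ`, coefficients polynomial in `π, s, α`) of the antiderivative's component `A` (pure polynomial part). [instance data] -/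
def LA (s : ℝ) : List ℝ :=
  [0, 0, 0, (16 / 3 : ℝ) * π ^ 4, 0, (-32 / 5 : ℝ) * π ^ 2 + (16 / 5 : ℝ) * π ^ 4 * s ^ 2, 0, (16 / 7 : ℝ) + (-32 / 7 : ℝ) * π ^ 2 * s ^ 2, 0, (16 / 9 : ℝ) * s ^ 2]

/-- Horner coefficient list (in `θ`, coefficients polynomial in `π, s, α`) of the antiderivative's component `B` (coefficient of `sin θ`). [instance data] -/
def LB (s α : ℝ) : List ℝ :=
  [(-40320 : ℝ) * α + (-201600 : ℝ) * s * α + (-2880 : ℝ) * π ^ 2 * α + (-12480 : ℝ) * π ^ 2 * s * α + (-144 : ℝ) * π ^ 4 * α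
      + (-528 : ℝ) * π ^ 4 * s * α + (-8 : ℝ) * π ^ 6 * α + (-24 : ℝ) * π ^ 6 * s * α + (-1 : ℝ) * π ^ 8 * α + (-1 : ℝ) * π ^ 8 * s * α,
    0,
    (20160 : ℝ) * α + (100800 : ℝ) * s * α + (1440 : ℝ) * π ^ 2 * α + (6240 : ℝ) * π ^ 2 * s * α + (72 : ℝ) * π ^ 4 * α + (264 : ℝ) * π ^ 4 * s * α
      + (4 : ℝ) * π ^ 6 * α + (12 : ℝ) * π ^ 6 * s * α,
    0, (-1680 : ℝ) * α + (-8400 : ℝ) * s * α + (-120 : ℝ) * π ^ 2 * α + (-520 : ℝ) * π ^ 2 * s * α + (-6 : ℝ) * π ^ 4 * α + (-30 : ℝ) * π ^ 4 * s * α, 0,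
    (56 : ℝ) * α + (280 : ℝ) * s * α + (4 : ℝ) * π ^ 2 * α + (28 : ℝ) * π ^ 2 * s * α, 0, (-1 : ℝ) * α + (-9 : ℝ) * s * α]

/-- Horner coefficient list (in `θ`, coefficients polynomial in `π, s, α`) of the antiderivative's component `C` (coefficient of `cos θ`). [instance data] -/
def LC (s α : ℝ) : List ℝ :=
  [0,
    (40320 : ℝ) * α + (201600 : ℝ) * s * α + (2880 : ℝ) * π ^ 2 * α + (12480 : ℝ) * π ^ 2 * s * α + (144 : ℝ) * π ^ 4 * α + (528 : ℝ) * π ^ 4 * s * α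
      + (8 : ℝ) * π ^ 6 * α + (24 : ℝ) * π ^ 6 * s * α + (1 : ℝ) * π ^ 8 * s * α,
    0,
    (-6720 : ℝ) * α + (-33600 : ℝ) * s * α + (-480 : ℝ) * π ^ 2 * α + (-2080 : ℝ) * π ^ 2 * s * α + (-24 : ℝ) * π ^ 4 * α + (-88 : ℝ) * π ^ 4 * s * α
      + (-4 : ℝ) * π ^ 6 * s * α,
    0, (336 : ℝ) * α + (1680 : ℝ) * s * α + (24 : ℝ) * π ^ 2 * α + (104 : ℝ) * π ^ 2 * s * α + (6 : ℝ) * π ^ 4 * s * α, 0,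
    (-8 : ℝ) * α + (-40 : ℝ) * s * α + (-4 : ℝ) * π ^ 2 * s * α, 0, (1 : ℝ) * s * α]

/-- Horner coefficient list (in `θ`, coefficients polynomial in `π, s, α`) of the antiderivative's component `D` (coefficient of `sin θ cos θ`). [instance data] -/
def LD (α : ℝ) : List ℝ :=
  [(45 / 4 : ℝ) * α ^ 2 + (3 / 2 : ℝ) * π ^ 2 * α ^ 2 + (-1 / 2 : ℝ) * π ^ 4 * α ^ 2 + (-1 : ℝ) * π ^ 6 * α ^ 2 + (-1 / 2 : ℝ) * π ^ 8 * α ^ 2, 0,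
    (-45 / 2 : ℝ) * α ^ 2 + (-3 : ℝ) * π ^ 2 * α ^ 2 + (1 : ℝ) * π ^ 4 * α ^ 2 + (2 : ℝ) * π ^ 6 * α ^ 2, 0,
    (15 / 2 : ℝ) * α ^ 2 + (1 : ℝ) * π ^ 2 * α ^ 2 + (-3 : ℝ) * π ^ 4 * α ^ 2, 0, (-1 : ℝ) * α ^ 2 + (2 : ℝ) * π ^ 2 * α ^ 2, 0, (-1 / 2 : ℝ) * α ^ 2]

/-- Horner coefficient list (in `θ`, coefficients polynomial in `π, s, α`) of the antiderivative's component `E` (coefficient of `sin²θ`). [instance data] -/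
def LE (α : ℝ) : List ℝ :=
  [0, (45 / 4 : ℝ) * α ^ 2 + (3 / 2 : ℝ) * π ^ 2 * α ^ 2 + (-1 / 2 : ℝ) * π ^ 4 * α ^ 2 + (-1 : ℝ) * π ^ 6 * α ^ 2 + (1 / 2 : ℝ) * π ^ 8 * α ^ 2, 0,
    (-15 / 2 : ℝ) * α ^ 2 + (-1 : ℝ) * π ^ 2 * α ^ 2 + (17 / 3 : ℝ) * π ^ 4 * α ^ 2 + (-2 / 3 : ℝ) * π ^ 6 * α ^ 2, 0,
    (3 / 2 : ℝ) * α ^ 2 + (-31 / 5 : ℝ) * π ^ 2 * α ^ 2 + (3 / 5 : ℝ) * π ^ 4 * α ^ 2, 0, (15 / 7 : ℝ) * α ^ 2 + (-2 / 7 : ℝ) * π ^ 2 * α ^ 2, 0,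
    (1 / 18 : ℝ) * α ^ 2]

/-- Horner coefficient list (in `θ`, coefficients polynomial in `π, s, α`) of the antiderivative's component `G` (coefficient of `cos²θ`). [instance data] -/
def LG (α : ℝ) : List ℝ :=
  [0, (-45 / 4 : ℝ) * α ^ 2 + (-3 / 2 : ℝ) * π ^ 2 * α ^ 2 + (1 / 2 : ℝ) * π ^ 4 * α ^ 2 + (1 : ℝ) * π ^ 6 * α ^ 2 + (1 / 2 : ℝ) * π ^ 8 * α ^ 2, 0,
    (15 / 2 : ℝ) * α ^ 2 + (1 : ℝ) * π ^ 2 * α ^ 2 + (-1 / 3 : ℝ) * π ^ 4 * α ^ 2 + (-2 / 3 : ℝ) * π ^ 6 * α ^ 2, 0,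
    (-3 / 2 : ℝ) * α ^ 2 + (-1 / 5 : ℝ) * π ^ 2 * α ^ 2 + (3 / 5 : ℝ) * π ^ 4 * α ^ 2, 0, (1 / 7 : ℝ) * α ^ 2 + (-2 / 7 : ℝ) * π ^ 2 * α ^ 2, 0,
    (1 / 18 : ℝ) * α ^ 2]

/-- THE ANTIDERIVATIVE `F(θ) = A(θ) + B(θ) sin θ + C(θ) cos θ + D(θ) sin θ cos θ + E(θ) sin²θ + G(θ) cos²θ` of the bump's
`s–α` energy density, with `A, …, G` the Horner lists `LA, …, LG`; constructed so that `F′ =` integrand holds as a POLYNOMIAL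
IDENTITY in `θ, sin θ, cos θ` (the components solve `C″ + C = (P_C)′ − P_S`, `B = P_C − C′`, `G″ + 4G = 2∫P_SS`, `D = −G′`,
`E = ∫P_SS − G` for the integrand `P₀ + P_S sin θ + P_C cos θ + P_SS sin²θ`). [instance data] -/
def F (s α : ℝ) (θ : ℝ) : ℝ :=
  hornerEval (LA s) θ + hornerEval (LB s α) θ * Real.sin θ + hornerEval (LC s α) θ * Real.cos θ
    + hornerEval (LD α) θ * Real.sin θ * Real.cos θ + hornerEval (LE α) θ * (Real.sin θ * Real.sin θ)
    + hornerEval (LG α) θ * (Real.cos θ * Real.cos θ)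

/-- `F′(θ)` is EXACTLY the `s–α` energy density of the quartic bump, at every `θ` and every `(s, α)`. [instance data] -/
theorem hasDerivAt_F (s α θ : ℝ) : HasDerivAt (F s α) (SAlpha.energyDensity s α bumpX bumpX' θ) θ := by
  have hS := Real.hasDerivAt_sin θ
  have hC := Real.hasDerivAt_cos θ
  have hA := hasDerivAt_hornerEval (LA s) θ
  have hB := (hasDerivAt_hornerEval (LB s α) θ).mul hS
  have hCc := (hasDerivAt_hornerEval (LC s α) θ).mul hC
  have hD := ((hasDerivAt_hornerEval (LD α) θ).mul hS).mul hC
  have hE := (hasDerivAt_hornerEval (LE α) θ).mul (hS.mul hS)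
  have hG := (hasDerivAt_hornerEval (LG α) θ).mul (hC.mul hC)
  have h := ((((hA.add hB).add hCc).add hD).add hE).add hG
  refine h.congr_deriv ?_
  simp only [hornerDeriv, hornerEval, LA, LB, LC, LD, LE, LG, SAlpha.energyDensity, SAlpha.bending, SAlpha.drive,
    SAlpha.shearParam, bumpX, bumpX', Pi.mul_apply]
  ring

/-- (A) THE CLOSED FORM: the `s–α` energy of the quartic bump on `[−π, π]` is the conic,
`SAlpha.energy s α X X′ (−π) π = c₀ + c₁ s² + c₂ sα + c₃ α² + c₄ α` — exact, every `(s, α)`; `W/c₀ ≈ 1 + 3.290 s² − 4.797 sα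
+ 2.186 α² − 2.065 α`.  MODEL `s–α` ((12.97)); nothing about a device. [instance data] -/
theorem energy_eq_conic (s α : ℝ) : SAlpha.energy s α bumpX bumpX' (-π) π = conic s α := by
  unfold SAlpha.energy
  rw [intervalIntegral.integral_eq_sub_of_hasDerivAt (fun θ _ => hasDerivAt_F s α θ)
    ((continuous_energyDensity_bump s α).intervalIntegrable _ _)]
  simp only [F, hornerEval, LA, LB, LC, LD, LE, LG, conic, c0, c1, c2, c3, c4, Real.sin_neg, Real.cos_neg, Real.sin_pi,
    Real.cos_pi]
  ring

/-! ### §4 The certified inner region of the unstable band -/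

/-- (B) INSIDE THE CONIC THE MODEL IS BALLOONING-UNSTABLE IN THE PRINTED SENSE: if `c₀ + c₁ s² + c₂ sα + c₃ α² + c₄ α < 0`
then the quartic bump on `[−π, π]` is an `SAlpha.UnstableWitness` for the surface `(s, α)` — a compactly supported trial
function with negative one-surface energy («if one can find an `l` dependence of `X` … that makes `W̄ < 0` … The plasma is
unstable», Freidberg §12.3).  Sufficient, not necessary: an INNER region (interior of an ellipse) of the model's unstable band.
MODEL `s–α`; the step to the 2-D `δW` is quoted in the Literature file, not typed. [instance data] -/
theorem unstableWitness_of_conic_neg {s α : ℝ} (h : conic s α < 0) :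
    SAlpha.UnstableWitness s α (-π) π bumpX bumpX' := by
  unfold SAlpha.UnstableWitness
  refine ⟨by linarith [Real.pi_pos], fun θ _ => hasDerivAt_bumpX θ, bumpX_neg_pi, bumpX_pi, ?_⟩
  rw [energy_eq_conic]
  exact h

/-- Enclosure `7363 < c0 < 7364` from `3.141592 < π < 3.141593`. [instance data] -/
theorem c0_bounds : (7363 : ℝ) < c0 ∧ c0 < 7364 := by
  have hlo := Real.pi_gt_d6
  have hhi := Real.pi_lt_d6
  have hpi := Real.pi_pos.le
  have hlo7 : (3.141592 : ℝ) ^ 7 < π ^ 7 := pow_lt_pow_left₀ hlo (by norm_num) (by norm_num)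
  have hhi7 : π ^ 7 < (3.141593 : ℝ) ^ 7 := pow_lt_pow_left₀ hhi hpi (by norm_num)
  unfold c0
  norm_num at hlo7 hhi7
  constructor <;> linarith

/-- Enclosure `24225 < c1 < 24226` from `3.141592 < π < 3.141593`. [instance data] -/
theorem c1_bounds : (24225 : ℝ) < c1 ∧ c1 < 24226 := by
  have hlo := Real.pi_gt_d6
  have hhi := Real.pi_lt_d6
  have hpi := Real.pi_pos.le
  have hlo9 : (3.141592 : ℝ) ^ 9 < π ^ 9 := pow_lt_pow_left₀ hlo (by norm_num) (by norm_num)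
  have hhi9 : π ^ 9 < (3.141593 : ℝ) ^ 9 := pow_lt_pow_left₀ hhi hpi (by norm_num)
  unfold c1
  norm_num at hlo9 hhi9
  constructor <;> linarith

/-- Enclosure `-35328 < c2 < -35325` from `3.141592 < π < 3.141593`. [instance data] -/
theorem c2_bounds : (-35328 : ℝ) < c2 ∧ c2 < -35325 := by
  have hlo := Real.pi_gt_d6
  have hhi := Real.pi_lt_d6
  have hpi := Real.pi_pos.le
  have hlo3 : (3.141592 : ℝ) ^ 3 < π ^ 3 := pow_lt_pow_left₀ hlo (by norm_num) (by norm_num)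
  have hhi3 : π ^ 3 < (3.141593 : ℝ) ^ 3 := pow_lt_pow_left₀ hhi hpi (by norm_num)
  have hlo5 : (3.141592 : ℝ) ^ 5 < π ^ 5 := pow_lt_pow_left₀ hlo (by norm_num) (by norm_num)
  have hhi5 : π ^ 5 < (3.141593 : ℝ) ^ 5 := pow_lt_pow_left₀ hhi hpi (by norm_num)
  unfold c2
  norm_num at hlo3 hhi3 hlo5 hhi5
  constructor <;> linarith

/-- Enclosure `16096 < c3 < 16097` from `3.141592 < π < 3.141593`. [instance data] -/
theorem c3_bounds : (16096 : ℝ) < c3 ∧ c3 < 16097 := by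
  have hlo := Real.pi_gt_d6
  have hhi := Real.pi_lt_d6
  have hpi := Real.pi_pos.le
  have hlo3 : (3.141592 : ℝ) ^ 3 < π ^ 3 := pow_lt_pow_left₀ hlo (by norm_num) (by norm_num)
  have hhi3 : π ^ 3 < (3.141593 : ℝ) ^ 3 := pow_lt_pow_left₀ hhi hpi (by norm_num)
  have hlo7 : (3.141592 : ℝ) ^ 7 < π ^ 7 := pow_lt_pow_left₀ hlo (by norm_num) (by norm_num)
  have hhi7 : π ^ 7 < (3.141593 : ℝ) ^ 7 := pow_lt_pow_left₀ hhi hpi (by norm_num)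
  have hlo9 : (3.141592 : ℝ) ^ 9 < π ^ 9 := pow_lt_pow_left₀ hlo (by norm_num) (by norm_num)
  have hhi9 : π ^ 9 < (3.141593 : ℝ) ^ 9 := pow_lt_pow_left₀ hhi hpi (by norm_num)
  unfold c3
  norm_num at hlo3 hhi3 hlo7 hhi7 hlo9 hhi9
  constructor <;> linarith

/-- Enclosure `-15211 < c4 < -15209` from `3.141592 < π < 3.141593`. [instance data] -/
theorem c4_bounds : (-15211 : ℝ) < c4 ∧ c4 < -15209 := by
  have hlo := Real.pi_gt_d6
  have hhi := Real.pi_lt_d6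
  have hpi := Real.pi_pos.le
  have hlo3 : (3.141592 : ℝ) ^ 3 < π ^ 3 := pow_lt_pow_left₀ hlo (by norm_num) (by norm_num)
  have hhi3 : π ^ 3 < (3.141593 : ℝ) ^ 3 := pow_lt_pow_left₀ hhi hpi (by norm_num)
  unfold c4
  norm_num at hlo3 hhi3
  constructor <;> linarith

/-- The quadratic part of the conic is POSITIVE DEFINITE (`c₁ > 0`, `4c₁c₃ − c₂² > 0`), so `{conic < 0}` is the interior of an
ELLIPSE in the `(s, α)` plane: this one trial function certifies a BOUNDED inner region of the unstable band only. [instance data] -/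
theorem conic_quadraticPart_posDef : 0 < c1 ∧ 0 < 4 * c1 * c3 - c2 ^ 2 := by
  have h1 := c1_bounds; have h2 := c2_bounds; have h3 := c3_bounds
  refine ⟨by linarith [h1.1], ?_⟩
  have hsq : c2 ^ 2 < 35328 ^ 2 := by nlinarith [h2.1, h2.2]
  have hprod : (24225 : ℝ) * 16096 < c1 * c3 := by nlinarith [mul_pos (sub_pos.2 h1.1) (sub_pos.2 h3.1), h1.1, h3.1]
  nlinarith [hsq, hprod]

/-- The conic is negative at `(s, α) = (½, 1)` (`W ≈ -3356`). [instance data] -/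
theorem conic_neg_half_one : conic (1 / 2) 1 < 0 := by
  have h0 := c0_bounds; have h1 := c1_bounds; have h2 := c2_bounds; have h3 := c3_bounds; have h4 := c4_bounds
  unfold conic
  linarith [h0.1, h0.2, h1.1, h1.2, h2.1, h2.2, h3.1, h3.2, h4.1, h4.2]

/-- (C) INSTANCE: the surface `(s, α) = (½, 1)` of the `s–α` MODEL admits a compactly supported trial function with negative
one-surface energy (the quartic bump on one poloidal transit). MODEL `s–α`; no device. [instance data] -/
theorem unstableWitness_half_one : SAlpha.UnstableWitness (1 / 2) 1 (-π) π bumpX bumpX' :=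
  unstableWitness_of_conic_neg conic_neg_half_one

/-- The conic is negative at `(s, α) = (1, 1)` (`W ≈ -2850`). [instance data] -/
theorem conic_neg_one_one : conic 1 1 < 0 := by
  have h0 := c0_bounds; have h1 := c1_bounds; have h2 := c2_bounds; have h3 := c3_bounds; have h4 := c4_bounds
  unfold conic
  linarith [h0.1, h0.2, h1.1, h1.2, h2.1, h2.2, h3.1, h3.2, h4.1, h4.2]

/-- (C) INSTANCE: the surface `(s, α) = (1, 1)` of the `s–α` MODEL admits a compactly supported trial function with negative
one-surface energy (the quartic bump on one poloidal transit). MODEL `s–α`; no device. [instance data] -/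
theorem unstableWitness_one_one : SAlpha.UnstableWitness 1 1 (-π) π bumpX bumpX' :=
  unstableWitness_of_conic_neg conic_neg_one_one

/-- The conic is negative at `(s, α) = (1, 2)` (`W ≈ -5098`). [instance data] -/
theorem conic_neg_one_two : conic 1 2 < 0 := by
  have h0 := c0_bounds; have h1 := c1_bounds; have h2 := c2_bounds; have h3 := c3_bounds; have h4 := c4_bounds
  unfold conic
  linarith [h0.1, h0.2, h1.1, h1.2, h2.1, h2.2, h3.1, h3.2, h4.1, h4.2]

/-- (C) INSTANCE: the surface `(s, α) = (1, 2)` of the `s–α` MODEL admits a compactly supported trial function with negative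
one-surface energy (the quartic bump on one poloidal transit). MODEL `s–α`; no device. [instance data] -/
theorem unstableWitness_one_two : SAlpha.UnstableWitness 1 2 (-π) π bumpX bumpX' :=
  unstableWitness_of_conic_neg conic_neg_one_two

/-- The conic is negative at `(s, α) = (2, 3)` (`W ≈ -8453`). [instance data] -/
theorem conic_neg_two_three : conic 2 3 < 0 := by
  have h0 := c0_bounds; have h1 := c1_bounds; have h2 := c2_bounds; have h3 := c3_bounds; have h4 := c4_bounds
  unfold conic
  linarith [h0.1, h0.2, h1.1, h1.2, h2.1, h2.2, h3.1, h3.2, h4.1, h4.2]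

/-- (C) INSTANCE: the surface `(s, α) = (2, 3)` of the `s–α` MODEL admits a compactly supported trial function with negative
one-surface energy (the quartic bump on one poloidal transit). MODEL `s–α`; no device. [instance data] -/
theorem unstableWitness_two_three : SAlpha.UnstableWitness 2 3 (-π) π bumpX bumpX' :=
  unstableWitness_of_conic_neg conic_neg_two_three

/-- The conic at `s = 1` is negative at `α = 87/100` (`W ≈ −193`). [instance data] -/
theorem conic_neg_one_87 : conic 1 (87 / 100) < -100 := by
  have h0 := c0_bounds; have h1 := c1_bounds; have h2 := c2_bounds; have h3 := c3_bounds; have h4 := c4_bounds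
  unfold conic
  linarith [h0.1, h0.2, h1.1, h1.2, h2.1, h2.2, h3.1, h3.2, h4.1, h4.2]

/-- The conic at `s = 1` is negative at `α = 227/100` (`W ≈ −185`). [instance data] -/
theorem conic_neg_one_227 : conic 1 (227 / 100) < -100 := by
  have h0 := c0_bounds; have h1 := c1_bounds; have h2 := c2_bounds; have h3 := c3_bounds; have h4 := c4_bounds
  unfold conic
  linarith [h0.1, h0.2, h1.1, h1.2, h2.1, h2.2, h3.1, h3.2, h4.1, h4.2]

/-- A CERTIFIED SEGMENT OF THE BAND: at unit shear `s = 1`, EVERY surface with `87/100 ≤ α ≤ 227/100` is inside the conic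
(convexity in `α`: `c₃ > 0`; the conic's own `s = 1` band is `α ∈ (0.862…, 2.278…)`). [instance data] -/
theorem conic_neg_one_of_mem {α : ℝ} (h1 : 87 / 100 ≤ α) (h2 : α ≤ 227 / 100) : conic 1 α < 0 := by
  have ha := conic_neg_one_87
  have hb := conic_neg_one_227
  have h3 := c3_bounds
  have e : conic 1 α = ((227 / 100 - α) * conic 1 (87 / 100) + (α - 87 / 100) * conic 1 (227 / 100)) / (7 / 5)
      - c3 * (α - 87 / 100) * (227 / 100 - α) := by
    unfold conic; ring
  have p1 : (227 / 100 - α) * conic 1 (87 / 100) ≤ (227 / 100 - α) * (-100) :=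
    mul_le_mul_of_nonneg_left ha.le (by linarith)
  have p2 : (α - 87 / 100) * conic 1 (227 / 100) ≤ (α - 87 / 100) * (-100) :=
    mul_le_mul_of_nonneg_left hb.le (by linarith)
  have p3 : 0 ≤ c3 * (α - 87 / 100) * (227 / 100 - α) := by
    have : 0 ≤ (α - 87 / 100) * (227 / 100 - α) := mul_nonneg (by linarith) (by linarith)
    have hc3 : 0 ≤ c3 := by linarith [h3.1]
    nlinarith [mul_nonneg hc3 this]
  rw [e]
  have : ((227 / 100 - α) * conic 1 (87 / 100) + (α - 87 / 100) * conic 1 (227 / 100)) / (7 / 5) < 0 := by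
    apply div_neg_of_neg_of_pos _ (by norm_num)
    linarith
  linarith

/-- (C′) THE SEGMENT: every surface `(1, α)`, `87/100 ≤ α ≤ 227/100`, of the `s–α` MODEL admits a compactly supported trial
function with negative one-surface energy. MODEL `s–α`; an inner piece of the printed band at `s = 1`; no device. [instance data] -/
theorem unstableWitness_one_of_mem {α : ℝ} (h1 : 87 / 100 ≤ α) (h2 : α ≤ 227 / 100) :
    SAlpha.UnstableWitness 1 α (-π) π bumpX bumpX' :=
  unstableWitness_of_conic_neg (conic_neg_one_of_mem h1 h2)

end SAlphaQuarticBump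

end Summit.Ventures.FusionMHD.Models

end
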